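/-
Copyright: statement-level skeleton of a published paper (lit-balaban cell, Phase-2 proof seat p31, gen 24). No proof claims beyond what the
kernel checks below.
-/
import Literature.MathematicalPhysics.QuantumFieldTheory.BalabanImbrieJaffe1984to88.BIJ88Eq249GaugeCovarianceStepTorus
import Literature.MathematicalPhysics.QuantumFieldTheory.Balaban1983to89.B4Sect5WalkDecay

/-!
# `BalabanImbrieJaffe1984to88.BIJ88Eq249GaugeCovarianceUniformTorus` — T. Bałaban, J. Imbrie, A. Jaffe, *Effective action and cluster properties
of the abelian Higgs model*, Commun. Math. Phys. **114** (1988) 257–315 [BalabanImbrieJaffe1988], §2 pp. 264–265 [PDF 8–9], **(2.49) AND ITS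
"SIMILAR ESTIMATES" FOR THE GAUGE-FIELD COVARIANCE WITH *"M = O(1)"* TAKEN LITERALLY: ALL CONSTANTS — INCLUDING THE CUBE SIZE `M` OF THE WALK
EXPANSION AND THE NUMBER OF LABELS PER `r(e_k)`-CUBE — FIXED FROM `(d, L)` BEFORE THE TORUS, THE LEVEL AND THE REGION ARE CHOSEN.**  p. 264:
*"C^{(k)}_Λ(u) = Σ_ω C^{(k)}_{Λ,ω}(u), (2.42) where ω is a walk on a lattice of spacing M = O(1)"*; [6] = [Balaban1983RegularityDecay] p. 595: *"(5.15) for α depending on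
M and arbitrarily small if M is sufficiently large"*, p. 596: *"Finally we fix M such that γ₀⁻¹αe^{δ₂}c₂2^d < 1"*.  Gen 24's files state (2.49), (2.42), the (2.41)-shape decay, (2.46) and (2.47) for the
[6II] (2.156) Λ-covariance (`BIJ88Eq249GaugeCovarianceTorus`) and for the (4.3.3) Dirichlet propagators of [I] on `W_Λ` / `Wstep_Λ`
(`BIJ88Eq249GaugeCovarianceStepTorus`) for EVERY cube size `M_c` above explicit thresholds `K_R(d,L)`, `Θ₁(d,L)` and with `θ_W(M_c) < 1`, and (2.46)
for `s` labels above explicit largeness conditions; here the thresholds are DISCHARGED once and for all by the choice of pub-balaban's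
`B4Sect5WalkDecay.concl57_walk` (`M_c = ⌈max(K_R, Θ₁, 2Θ_W)⌉ + 5`, so `θ_W(M_c) ≤ ½` by `thetaW_le: θ_W(M) ≤ Θ_W/M`, and `(1 − θ_W)⁻¹ ≤ 2`), and
`s₀` by `e^x ≥ 1 + x`.  [I] = [BalabanImbrieJaffe1985] p. 325 on (7.2.3): *"this inequality also holds for propagators with Dirichlet boundary
conditions outside a domain Λ, uniformly in Λ"* — §3's decay clauses have every constant from `(d, L)`: uniform in `Λ`, in `k` and in the volume.

statement-level skeleton of published theorems with citation tags; proofs where landed; nothing here is a claim about the Yang–Mills mass gap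

PDF held: `paper:balaban1988-cmp114-bij-abelian-higgs-effective-action` (journal page = PDF page + 256; pp. 264–265 = PDF 8–9 re-read this session);
`paper:balaban1985-cmp97-bij-higgs-minimizers` (p. 311 = PDF 13, p. 325 = PDF 27 re-read this session);
`paper:balaban1983-cmp89-regularity-decay` (journal page = PDF page + 570; pp. 595–596 = PDF 25–26 re-read this session, `lit read … --pages 25-27`).

CITATION HEADER (lean-in-tree rule).  lit-balaban cell (HOME `run/shared/lean/pub/lit-balaban/`), Phase 2, proof seat **p31 gen 24** (unit `lit-balaban-p31`,
literature-prover-lit-balaban-p31-g24-0), free-target protocol G.5-34(d), TAKING #4 line HOME/STATUS.md (window 20 min; stem check `GaugeCovarianceUniform|UniformTorus`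
= ∅; cc r18, r15).  Rows served (CELLS, located members; heads unchanged): `HOME/lit-balaban-r18/ROWS-C2.md` **C2.Eq2.49**, C2.Eq2.41 / 2.42 / 2.46 / 2.47;
`HOME/lit-balaban-r15` C1.Eq4.3.3 / 4.3.5 / **C1.Eq7.2.3**.  Files USED BY NAME, nothing restated: gen 24 `BIJ88Eq249GaugeCovarianceTorus` (`HalfBox`, `cA`,
`cA_nonneg`, `sandw`, `walkK`, `eq249`, `hasSum_walk_cov`, `abs_cov_le_walk`, `close247_gauge`, `ineq246_gX`) and `BIJ88Eq249GaugeCovarianceStepTorus`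
(`kernel_stepLam_eq_cov`, `eq245_tsandw`, `hasSum_tsandw`, `abs_tsandw_le_of_decay`, `close_tsandw`, `close_idx`, `ineq246_tsandw`, `ineq246_idx`);
pub-balaban `B4Sect5WalkDecay.thetaW_le`, `B4Sect5Proof` (`latticeConst`, `weightConst`), `B4Sect5CubeBounds` (`kR`, `thetaConst`), `B6Cov2156TorusDelK`
(`reDelK`, `kernelDecay_reDelK`, `reDelK_isSymm`, `lowerOnConstrainedT_reDelK_sharp`, `gamma2153one`, `gamma2153one_pos`); p13 `BIJ88Ineq246Lattice`
(`thetaW`, `thetaW_nonneg`, `K0`), `BIJ88RandomWalk242` (`cLoc`, `cX`, `memX`, `subset_closure`); p09 / p27 (`idx`, `idx_fst_coe`, `L_dvd_Mk`, `Mk`,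
`one_le_Lpow`, `pdist_rep_eq_supDist`, `regaugeMat`, `rowBound`, `WcornerLam`, `kernel_cornerLam_eq_cov`, `WstepLam`); r18 `BIJ88Sect2Statements`
(`Eq245`, `Ineq246`, `Close`).

## What is proved (0 `sorry`; axioms standard; theorems only)

* §1 **`exists_cubeSize`** — for every `(d, N, γ₀ > 0, c₀ ≥ 0, δ₀ > 0)` a cube size `M_c ≥ 5` with `K_R < M_c`, `Θ₁ < M_c`, `θ_W(M_c) ≤ ½`;
  `inv_one_sub_le_two`; private `le_exp_mul_of_ge`.
* §2 **`eq249_DelK_uniform`** — `d ≥ 2`, `L ≥ 1`: `∃ c₀ δ₀ > 0, M_c ≥ 5, s₀` (from `(d, L)`) such that for every torus `L ∣ M_μ`, every level `n ≥ 1`, every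
  `Λ′₀` in half-torus position, the genuine `C^{(k)}_Λ = C_Λ(C_Λ*(Re Δ_k)C_Λ)⁻¹C_Λ*` satisfies: `Eq245` (all `ρ`, `s`) ∧ the unconditional walk expansion ∧
  `|C^{(k)}_Λ(b,b′)| ≤ 2^{d+1}γ′⁻¹e^{δ₀/4}e^{2δ′(L−1)}(L^d+1)²e^{−δ′ρ_M(b,b′)}` (`δ′ = δ₀/(8M_c)`) ∧ `Close` (all `ρ`; `δ = 2^{d+1}γ′⁻¹e^{−(δ₀/16)(ρ−3)}e^{2c(L−1)}(L^d+1)²`,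
  `c = δ₀/(16M_c)`) ∧ `Ineq246` with `c = δ₀/(256·9^d)` (all `s ≥ s₀`).
* §3 on the tori `Params` of the series: **`eq249_cornerLam_uniform`** (the Λ-Dirichlet propagator of [I] in the corner axial gauge `W_Λ`, torus distance
  `supDist`) and **`eq249_stepLam_uniform`** (the (4.3.3) propagator on `Wstep_Λ`; decay and `Close` constants `× e^{2δ′L}rowBound(d,L)²`, (2.46) with
  `c = δ₀/(512·9^d)` and the support reading of gen 24's Step file), same quantifier shape.
HONEST SCOPE.  (i) Geometry unchanged: `Λ = B(Λ′₀)` in HALF-TORUS POSITION (`HalfBox`); wrapping regions / the whole torus are not covered by the walk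
theorems.  (ii) The constants are EXISTENTIAL in the statements (`∃ c₀ δ₀ M_c s₀`), their provenance (`kernelDecay_reDelK` for `(c₀, δ₀)`: from `d`;
`M_c`, `s₀`: the displayed recipes) is in the proofs, not asserted as formulas; no optimality.  (iii) `s ≥ s₀` is the print's *"r(e_k) → ∞"* (p. 260)
made quantitative only as an eventual statement.  (iv) No background field.  No `def`, no new named fact (D-0026).  Unit `lit-balaban-p31`
(literature-prover-lit-balaban-p31-g24-0), 2026-08-23.  NOT summit progress.
-/

open scoped BigOperators Matrix
open Finset Matrix

namespace Literature.MathematicalPhysics.QuantumFieldTheory.BalabanImbrieJaffe1984to88.BIJ88Eq249GaugeCovarianceUniformTorus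

open Literature.MathematicalPhysics.QuantumFieldTheory.Balaban1983to89
open B6BondEliminationTorus (pdist)
open B6Lemma24Torus (pbox)
open B6Cov2156Torus (one_le_M)
open B6Cov2156TorusSubset (bondReductionLam lamFree elimLam)
open B6Cov2156TorusDelK (reDelK kernelDecay_reDelK reDelK_isSymm lowerOnConstrainedT_reDelK_sharp gamma2153one gamma2153one_pos)
open BIJ88RandomWalk242 BIJ88Eq242Lattice BIJ88Ineq246Lattice B4Sect5CubeBounds
open B4Sect5Proof (latticeConst weightConst)
open BIJ88Eq249GaugeCovarianceTorus

noncomputable section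

/-! ## §1 *"Finally we fix M"* ([6] p. 596): a cube size from the (5.6)-constants alone, with `θ_W ≤ ½` -/

/-- **THE CUBE SIZE IS A CONSTANT** ([6] p. 595 *"α depending on M and arbitrarily small if M is sufficiently large"*, p. 596 *"Finally we
fix M such that … < 1"*; [BIJ88] p. 264 *"a walk on a lattice of spacing M = O(1)"*): for every `(d, N, γ₀, c₀, δ₀)` with `γ₀, δ₀ > 0`, `c₀ ≥ 0` there is a cube size `M_c ≥ 5` above both walk thresholds `K_R`, `Θ₁`
with `θ_W(M_c) ≤ ½` (pub-balaban's `B4Sect5WalkDecay.thetaW_le`: `θ_W(M) ≤ Θ_W/M`; the choice of `concl57_walk`).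
[cite: Balaban1983RegularityDecay, (5.15) p.595, (5.21) p.596; BalabanImbrieJaffe1988, (2.42) p.264] -/
theorem exists_cubeSize (d N : ℕ) {γ₀ c₀ δ₀ : ℝ} (hγ : 0 < γ₀) (hc : 0 ≤ c₀) (hδ : 0 < δ₀) :
    ∃ Mc : ℕ, 5 ≤ Mc ∧ kR d N γ₀ c₀ δ₀ < Mc ∧ thetaConst d N γ₀ c₀ δ₀ < Mc ∧ thetaW d N γ₀ c₀ δ₀ Mc ≤ 1 / 2 := by
  set Θ := 3 ^ d * (latticeConst d (δ₀ / 8) * (Real.exp (δ₀ / 8) * γ₀⁻¹ *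
    (3 * Real.pi * d / 2 * weightConst d N c₀ δ₀ + c₀ * (N * latticeConst d (δ₀ / 4)) * (10 / δ₀)))) with hΘ
  set Mc : ℕ := ⌈max (max (kR d N γ₀ c₀ δ₀) (thetaConst d N γ₀ c₀ δ₀)) (2 * Θ)⌉₊ + 5 with hMdef
  have hM5 : 5 ≤ Mc := by omega
  have hM0 : 0 < Mc := by omega
  have hMr : (0 : ℝ) < Mc := by exact_mod_cast hM0
  have hceil : max (max (kR d N γ₀ c₀ δ₀) (thetaConst d N γ₀ c₀ δ₀)) (2 * Θ) < Mc := by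
    rw [hMdef]
    push_cast
    have := Nat.le_ceil (max (max (kR d N γ₀ c₀ δ₀) (thetaConst d N γ₀ c₀ δ₀)) (2 * Θ))
    linarith
  have hMR : kR d N γ₀ c₀ δ₀ < Mc := lt_of_le_of_lt ((le_max_left _ _).trans (le_max_left _ _)) hceil
  have hMθ : thetaConst d N γ₀ c₀ δ₀ < Mc := lt_of_le_of_lt ((le_max_right _ _).trans (le_max_left _ _)) hceil
  have h2Θ : 2 * Θ < Mc := lt_of_le_of_lt (le_max_right _ _) hceil
  refine ⟨Mc, hM5, hMR, hMθ, ?_⟩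
  have hθ0 : 0 ≤ thetaW d N γ₀ c₀ δ₀ Mc := thetaW_nonneg hc hδ hγ Mc
  have hθle : thetaW d N γ₀ c₀ δ₀ Mc ≤ Θ / Mc := B4Sect5WalkDecay.thetaW_le hγ hc hδ hM0
  refine hθle.trans ?_
  rw [div_le_iff₀ hMr]
  have : 0 ≤ Θ := (mul_nonneg hθ0 hMr.le).trans ((le_div_iff₀ hMr).mp hθle)
  linarith

/-- kernel: with `θ_W ≤ ½`, `(1 − θ_W)⁻¹ ≤ 2`. [cite: Balaban1983RegularityDecay, (5.21) p.596] -/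
theorem inv_one_sub_le_two {θ : ℝ} (h : θ ≤ 1 / 2) : (1 - θ)⁻¹ ≤ 2 := by
  rw [inv_le_comm₀ (by linarith) (by norm_num)]
  linarith

/-- kernel: `e^{as} ≥ K` as soon as `s ≥ K/a` (`a > 0`), by `e^x ≥ x + 1`. [folklore] -/
private theorem le_exp_mul_of_ge {a K : ℝ} (ha : 0 < a) {s : ℕ} (hs : K / a ≤ s) : K ≤ Real.exp (a * s) := by
  have h1 : K ≤ a * s := by rwa [div_le_iff₀' ha] at hs
  linarith [Real.add_one_le_exp (a * s)]

variable {d L : ℕ}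

/-! ## §2 (2.49) AND ITS ESTIMATES FOR THE GENUINE GAUGE-FIELD COVARIANCE WITH ALL CONSTANTS — INCLUDING THE CUBE SIZE — FIXED FROM `(d, L)` -/

/-- **(2.49) WITH *"M = O(1)"* (p. 264) LITERALLY: constants before the instance.**  For `d ≥ 2`, `L ≥ 1` there are `c₀, δ₀ > 0`, a cube size
`M_c ≥ 5` and a number of labels `s₀` — ALL FROM `(d, L)` — such that for every torus (`L ∣ M_μ`), every level `n ≥ 1` and every `Λ = B(Λ′₀)` in
half-torus position, the genuine gauge-field covariance `C^{(k)}_Λ = C_Λ(C_Λ*(Re Δ_k)C_Λ)⁻¹C_Λ*` of [6II] (2.156) satisfies, for the pieces of gen 24's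
`BIJ88Eq249GaugeCovarianceTorus` on the `M_c`-cubes: (2.49) `Eq245` for every `ρ`, `s`; (2.42) the unconditional walk expansion; the (2.41)-shape
decay `|C^{(k)}_Λ(b,b′)| ≤ 2^{d+1}γ′^{−1}e^{δ₀/4}e^{2δ′(L−1)}(L^d+1)²e^{−δ′ρ_M(b,b′)}`, `δ′ = δ₀/(8M_c)`; (2.47) `Close` with
`δ = 2^{d+1}γ′^{−1}e^{−(δ₀/16)(ρ−3)}e^{2c(L−1)}(L^d+1)²`, `c = δ₀/(16M_c)`, every `ρ`; and (2.46) `Ineq246` with `c = δ₀/(256·9^d)` for every `s ≥ s₀`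
(`γ′ = (1/12d²)L^{−d−1}`, pv09's (2.153) constant). [cite: BalabanImbrieJaffe1988, (2.41)–(2.42) p.264, (2.46)–(2.47) pp.264–265, (2.49) p.265;
Balaban1983RegularityDecay, p.596 ("Finally we fix M"); Balaban1984PropagatorsII, (2.156) p.250] -/
theorem eq249_DelK_uniform (hd2 : 2 ≤ d) (hL : 1 ≤ L) :
    ∃ c₀ δ₀ : ℝ, ∃ Mc s₀ : ℕ, 0 < c₀ ∧ 0 < δ₀ ∧ 5 ≤ Mc ∧ ∀ (M : Fin d → ℕ) [∀ μ, NeZero (M μ)], (∀ i, L ∣ M i) → ∀ (n : ℕ) (hn : 1 ≤ n)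
      (Λ'₀ : Finset (Fin d → ℤ)), HalfBox L M Λ'₀ →
      (∀ (ρ : ℝ) (s : ℕ), BIJ88Sect2Statements.Eq245 (fun b b' : B4.Idx (pbox M) d => (bondReductionLam L M Λ'₀ (reDelK n hn M)).cov b b')
        (sandw L M Λ'₀ (cLoc (ldist (N := d) Mc) ρ (walkK L M Λ'₀ (reDelK n hn M) (gamma2153one d L) Mc)))
        (fun X : Finset (Cubes Mc s (pbox M)) =>
          sandw L M Λ'₀ (cX (ldist (N := d) Mc) ρ (cubeOf Mc s) touch (walkK L M Λ'₀ (reDelK n hn M) (gamma2153one d L) Mc) X))) ∧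
      (∀ b b' : B4.Idx (pbox M) d, HasSum (fun ω => sandw L M Λ'₀ (walkK L M Λ'₀ (reDelK n hn M) (gamma2153one d L) Mc ω) b b')
        ((bondReductionLam L M Λ'₀ (reDelK n hn M)).cov b b')) ∧
      (∀ b b' : B4.Idx (pbox M) d, |(bondReductionLam L M Λ'₀ (reDelK n hn M)).cov b b'| ≤
        2 ^ (d + 1) * (gamma2153one d L)⁻¹ * Real.exp (δ₀ / 4) * Real.exp (2 * (δ₀ / 8 / Mc) * ((L : ℝ) - 1)) * ((L : ℝ) ^ d + 1) *
          ((L : ℝ) ^ d + 1) * Real.exp (-(δ₀ / 8 / Mc * pdist M (one_le_M M) (b.1 : Fin d → ℤ) (b'.1 : Fin d → ℤ)))) ∧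
      (∀ ρ : ℝ, BIJ88Sect2Statements.Close (fun b b' : B4.Idx (pbox M) d => pdist M (one_le_M M) (b.1 : Fin d → ℤ) (b'.1 : Fin d → ℤ))
        (sandw L M Λ'₀ (cLoc (ldist (N := d) Mc) ρ (walkK L M Λ'₀ (reDelK n hn M) (gamma2153one d L) Mc)))
        (fun b b' => (bondReductionLam L M Λ'₀ (reDelK n hn M)).cov b b')
        (2 ^ (d + 1) * (gamma2153one d L)⁻¹ * Real.exp (-(δ₀ / 16 * (ρ - 3))) * Real.exp (2 * (δ₀ / 16 / Mc) * ((L : ℝ) - 1)) *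
          ((L : ℝ) ^ d + 1) * ((L : ℝ) ^ d + 1)) (δ₀ / 16 / Mc)) ∧
      (∀ s : ℕ, s₀ ≤ s → BIJ88Sect2Statements.Ineq246 (fun X : Finset (Cubes Mc s (pbox M)) => X.card)
        (fun (b : B4.Idx (pbox M) d) (X : Finset (Cubes Mc s (pbox M))) => ∃ k : ↥(lamFree L M Λ'₀), elimLam L M Λ'₀ b k ≠ 0 ∧
          memX (fun (x : B4.Idx (pbox M) d) (l : ↥(labels Mc (pbox M))) => InBox Mc l.1 (x.1 : Fin d → ℤ)) (cubeOf Mc s) touch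
            (k : B4.Idx (pbox M) d) X)
        (fun X b b' => sandw L M Λ'₀ (cX (ldist (N := d) Mc) ((s : ℝ) / 4) (cubeOf Mc s) touch
          (walkK L M Λ'₀ (reDelK n hn M) (gamma2153one d L) Mc) X) b b')
        (δ₀ / (256 * 9 ^ d)) s) := by
  obtain ⟨c₀, δ₀, hc, hδ, hK⟩ := kernelDecay_reDelK (d := d) (by omega)
  have hγ : 0 < gamma2153one d L := gamma2153one_pos (by omega) hL
  obtain ⟨Mc, hM5, hMR, hMθ, hθhalf⟩ := exists_cubeSize d d (γ₀ := gamma2153one d L) (c₀ := cA d L (gamma2153one d L) c₀ δ₀) (δ₀ := δ₀)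
    hγ (cA_nonneg d L hγ.le hc.le δ₀) hδ
  set γ := gamma2153one d L with hγdef
  have hθW : thetaW d d γ (cA d L γ c₀ δ₀) δ₀ Mc < 1 := by linarith
  have hinv : (1 - thetaW d d γ (cA d L γ c₀ δ₀) δ₀ Mc)⁻¹ ≤ 2 := inv_one_sub_le_two hθhalf
  -- the number of labels absorbing the (2.46) prefactors: `K₀ ≤ 2^{d+1}γ⁻¹e^{δ₀/8} ≤ e^{(δ₀/(128·9^d))s}`, `(L^d+1)² ≤ e^{(δ₀/(256·9^d))s}`
  set s₀ : ℕ := max ⌈(2 ^ (d + 1) * γ⁻¹ * Real.exp (δ₀ / 8)) / (δ₀ / (128 * 9 ^ d))⌉₊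
    ⌈(((L : ℝ) ^ d + 1) * ((L : ℝ) ^ d + 1)) / (δ₀ / (256 * 9 ^ d))⌉₊ with hs₀
  refine ⟨c₀, δ₀, Mc, s₀, hc, hδ, hM5, fun M _ hLM n hn Λ'₀ hbox => ?_⟩
  have hL0 : 0 < L := by omega
  have hs := reDelK_isSymm n hn M
  have hd := hK M n hn
  have hl := lowerOnConstrainedT_reDelK_sharp hd2 hL n hn hLM
  refine ⟨fun ρ s => eq249 hL0 hLM hγ hc.le hδ hs hd hl hbox hM5 hMR hMθ ρ s,
    fun b b' => hasSum_walk_cov hL0 hLM hγ hc.le hδ hs hd hl hbox hM5 hMR hMθ b b', fun b b' => ?_, fun ρ => ?_, fun s hs0 => ?_⟩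
  · refine (abs_cov_le_walk hL0 hLM hγ hc.le hδ hs hd hl hbox hM5 hMR hMθ hθW b b').trans ?_
    have hE := Real.exp_pos (-(δ₀ / 8 / Mc * pdist M (one_le_M M) (b.1 : Fin d → ℤ) (b'.1 : Fin d → ℤ)))
    calc 2 ^ d * γ⁻¹ * (1 - thetaW d d γ (cA d L γ c₀ δ₀) δ₀ Mc)⁻¹ * Real.exp (δ₀ / 4) *
          Real.exp (2 * (δ₀ / 8 / Mc) * ((L : ℝ) - 1)) * ((L : ℝ) ^ d + 1) * ((L : ℝ) ^ d + 1) *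
          Real.exp (-(δ₀ / 8 / Mc * pdist M (one_le_M M) (b.1 : Fin d → ℤ) (b'.1 : Fin d → ℤ)))
        ≤ 2 ^ d * γ⁻¹ * 2 * Real.exp (δ₀ / 4) *
          Real.exp (2 * (δ₀ / 8 / Mc) * ((L : ℝ) - 1)) * ((L : ℝ) ^ d + 1) * ((L : ℝ) ^ d + 1) *
          Real.exp (-(δ₀ / 8 / Mc * pdist M (one_le_M M) (b.1 : Fin d → ℤ) (b'.1 : Fin d → ℤ))) := by gcongr
      _ = _ := by ring
  · intro b b'
    refine (close247_gauge hL0 hLM hγ hc.le hδ hs hd hl hbox hM5 hMR hMθ hθW ρ b b').trans ?_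
    have hE := Real.exp_pos (-(δ₀ / 16 / Mc) * pdist M (one_le_M M) (b.1 : Fin d → ℤ) (b'.1 : Fin d → ℤ))
    calc 2 ^ d * γ⁻¹ * (1 - thetaW d d γ (cA d L γ c₀ δ₀) δ₀ Mc)⁻¹ * Real.exp (-(δ₀ / 16 * (ρ - 3))) *
          Real.exp (2 * (δ₀ / 16 / Mc) * ((L : ℝ) - 1)) * ((L : ℝ) ^ d + 1) * ((L : ℝ) ^ d + 1) *
          Real.exp (-(δ₀ / 16 / Mc) * pdist M (one_le_M M) (b.1 : Fin d → ℤ) (b'.1 : Fin d → ℤ))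
        ≤ 2 ^ d * γ⁻¹ * 2 * Real.exp (-(δ₀ / 16 * (ρ - 3))) *
          Real.exp (2 * (δ₀ / 16 / Mc) * ((L : ℝ) - 1)) * ((L : ℝ) ^ d + 1) * ((L : ℝ) ^ d + 1) *
          Real.exp (-(δ₀ / 16 / Mc) * pdist M (one_le_M M) (b.1 : Fin d → ℤ) (b'.1 : Fin d → ℤ)) := by gcongr
      _ = _ := by ring
  · have hs0' : 0 < s := by
      rcases Nat.eq_zero_or_pos s with h0 | hpos
      · exfalso
        have h1 : ⌈(((L : ℝ) ^ d + 1) * ((L : ℝ) ^ d + 1)) / (δ₀ / (256 * 9 ^ d))⌉₊ ≤ s := (le_max_right _ _).trans hs0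
        rw [h0, Nat.le_zero, Nat.ceil_eq_zero] at h1
        have h2 : 0 < (((L : ℝ) ^ d + 1) * ((L : ℝ) ^ d + 1)) / (δ₀ / (256 * 9 ^ d)) := by positivity
        linarith
      · exact hpos
    have hK0 : K0 d d γ (cA d L γ c₀ δ₀) δ₀ Mc ≤ Real.exp (δ₀ / (128 * 9 ^ d) * s) := by
      have h1 : K0 d d γ (cA d L γ c₀ δ₀) δ₀ Mc ≤ 2 ^ (d + 1) * γ⁻¹ * Real.exp (δ₀ / 8) := by
        unfold K0
        calc 2 ^ d * γ⁻¹ * (1 - thetaW d d γ (cA d L γ c₀ δ₀) δ₀ Mc)⁻¹ * Real.exp (δ₀ / 8)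
            ≤ 2 ^ d * γ⁻¹ * 2 * Real.exp (δ₀ / 8) := by gcongr
          _ = _ := by ring
      refine h1.trans (le_exp_mul_of_ge (by positivity) ?_)
      have h2 : ⌈(2 ^ (d + 1) * γ⁻¹ * Real.exp (δ₀ / 8)) / (δ₀ / (128 * 9 ^ d))⌉₊ ≤ s := (le_max_left _ _).trans hs0
      exact (Nat.le_ceil _).trans (by exact_mod_cast h2)
    have hLL : ((L : ℝ) ^ d + 1) * ((L : ℝ) ^ d + 1) ≤ Real.exp (δ₀ / (256 * 9 ^ d) * s) := by
      refine le_exp_mul_of_ge (by positivity) ?_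
      have h2 : ⌈(((L : ℝ) ^ d + 1) * ((L : ℝ) ^ d + 1)) / (δ₀ / (256 * 9 ^ d))⌉₊ ≤ s := (le_max_right _ _).trans hs0
      exact (Nat.le_ceil _).trans (by exact_mod_cast h2)
    exact ineq246_gX hL0 hLM hγ hc.le hδ hs hd hl hbox hM5 hMR hMθ hθW hs0' hK0 hLL


/-! ## §3 ON THE TORI OF THE SERIES: THE Λ-DIRICHLET PROPAGATORS OF [I] IN THE CORNER GAUGE (`W_Λ`, p09) AND THE ONE-STEP AXIAL GAUGE (`Wstep_Λ`, p27) -/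

section BIJ85

open LatticeFieldCalculus (supDist)
open BIJ85AxialPropagator411 (curlOp V411)
open BIJ85UnitPropagator433 (unitPropagator)
open BIJ85Prop521Torus (QsE)
open BIJ85Ineq723Torus (regaugeMat rowBound rowBound_pos)
open BIJ85Ineq723TorusCornerGauge (idx idx_fst_coe L_dvd_Mk)
open BIJ85Ineq723TorusDirichlet (WcornerLam kernel_cornerLam_eq_cov)
open BIJ85Ineq723TorusDirichletStep (WstepLam)
open BIJ85Eq431DeltaKBridge (one_le_Lpow pdist_rep_eq_supDist)
open B5Eq117TorusCarriers (Mk)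
open BIJ88Eq249GaugeCovarianceStepTorus

/-- **(2.49) AND ITS ESTIMATES FOR THE Λ-DIRICHLET PROPAGATOR OF [I] IN BAŁABAN'S CORNER AXIAL GAUGE, ALL CONSTANTS FROM `(d, L)`** (kernel
`= C^{(k)}_Λ∘idx`, p09's `kernel_cornerLam_eq_cov`): `c₀, δ₀ > 0`, a cube size `M_c ≥ 5` and a label count `s₀` such that for every torus `Params` with
these `(d, L)` (`d ≥ 2`, `L ≥ 1`), every `k + 1 ≤ m + K` and every `Λ′₀` in half-torus position: (2.49) `Eq245` (every `ρ`, `s`), (2.42) the unconditional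
walk expansion, the (2.41)/(7.2.3)-shape decay `2^{d+1}γ′^{−1}e^{δ₀/4}e^{2δ′(L−1)}(L^d+1)²e^{−δ′|b₋−b′₋|}` (`δ′ = δ₀/(8M_c)`), (2.47) `Close` in `supDist`
(every `ρ`), (2.46) `Ineq246` with `c = δ₀/(256·9^d)` (every `s ≥ s₀`). [cite: BalabanImbrieJaffe1988, (2.49) p.265, (2.41)–(2.47) pp.264–265;
BalabanImbrieJaffe1985, (4.3.5) p.311, (7.2.3) p.325] -/
theorem eq249_cornerLam_uniform (d L : ℕ) (hd2 : 2 ≤ d) (hL : 1 ≤ L) :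
    ∃ c₀ δ₀ : ℝ, ∃ Mc s₀ : ℕ, 0 < c₀ ∧ 0 < δ₀ ∧ 5 ≤ Mc ∧ ∀ (P : Params), P.d = d → P.L = L → ∀ (k : ℕ) [DecidableEq (PBond P k)]
      (hk : k + 1 ≤ P.m + P.K) (Λ'₀ : Finset (Fin P.d → ℤ)), HalfBox P.L (Mk P k) Λ'₀ →
      (∀ (ρ : ℝ) (s : ℕ), BIJ88Sect2Statements.Eq245
        (fun b b' : PBond P k =>
          unitPropagator (V411 P k) (curlOp (P := P) (P.eta k ^ P.d) ((P.L : ℝ) ^ k)) (QsE P k) (WcornerLam P k Λ'₀) (EuclideanSpace.single b' 1) b)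
        (fun b b' => sandw P.L (Mk P k) Λ'₀ (cLoc (ldist (N := P.d) Mc) ρ
          (walkK P.L (Mk P k) Λ'₀ (reDelK (P.L ^ k) (one_le_Lpow P k) (Mk P k)) (gamma2153one P.d P.L) Mc)) (idx P k b) (idx P k b'))
        (fun (X : Finset (Cubes Mc s (pbox (Mk P k)))) b b' => sandw P.L (Mk P k) Λ'₀ (cX (ldist (N := P.d) Mc) ρ (cubeOf Mc s) touch
          (walkK P.L (Mk P k) Λ'₀ (reDelK (P.L ^ k) (one_le_Lpow P k) (Mk P k)) (gamma2153one P.d P.L) Mc) X) (idx P k b) (idx P k b'))) ∧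
      (∀ b b' : PBond P k, HasSum (fun ω => sandw P.L (Mk P k) Λ'₀
          (walkK P.L (Mk P k) Λ'₀ (reDelK (P.L ^ k) (one_le_Lpow P k) (Mk P k)) (gamma2153one P.d P.L) Mc ω) (idx P k b) (idx P k b'))
        (unitPropagator (V411 P k) (curlOp (P := P) (P.eta k ^ P.d) ((P.L : ℝ) ^ k)) (QsE P k) (WcornerLam P k Λ'₀) (EuclideanSpace.single b' 1) b)) ∧
      (∀ b b' : PBond P k,
        |unitPropagator (V411 P k) (curlOp (P := P) (P.eta k ^ P.d) ((P.L : ℝ) ^ k)) (QsE P k) (WcornerLam P k Λ'₀) (EuclideanSpace.single b' 1) b| ≤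
          2 ^ (P.d + 1) * (gamma2153one P.d P.L)⁻¹ * Real.exp (δ₀ / 4) * Real.exp (2 * (δ₀ / 8 / Mc) * ((P.L : ℝ) - 1)) * ((P.L : ℝ) ^ P.d + 1) *
            ((P.L : ℝ) ^ P.d + 1) * Real.exp (-(δ₀ / 8 / Mc * (supDist b.src b'.src : ℝ)))) ∧
      (∀ ρ : ℝ, BIJ88Sect2Statements.Close (fun b b' : PBond P k => (supDist b.src b'.src : ℝ))
        (fun b b' => sandw P.L (Mk P k) Λ'₀ (cLoc (ldist (N := P.d) Mc) ρ
          (walkK P.L (Mk P k) Λ'₀ (reDelK (P.L ^ k) (one_le_Lpow P k) (Mk P k)) (gamma2153one P.d P.L) Mc)) (idx P k b) (idx P k b'))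
        (fun b b' : PBond P k =>
          unitPropagator (V411 P k) (curlOp (P := P) (P.eta k ^ P.d) ((P.L : ℝ) ^ k)) (QsE P k) (WcornerLam P k Λ'₀) (EuclideanSpace.single b' 1) b)
        (2 ^ (P.d + 1) * (gamma2153one P.d P.L)⁻¹ * Real.exp (-(δ₀ / 16 * (ρ - 3))) * Real.exp (2 * (δ₀ / 16 / Mc) * ((P.L : ℝ) - 1)) *
          ((P.L : ℝ) ^ P.d + 1) * ((P.L : ℝ) ^ P.d + 1)) (δ₀ / 16 / Mc)) ∧
      (∀ s : ℕ, s₀ ≤ s → BIJ88Sect2Statements.Ineq246 (fun X : Finset (Cubes Mc s (pbox (Mk P k))) => X.card)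
        (fun (b : PBond P k) (X : Finset (Cubes Mc s (pbox (Mk P k)))) => ∃ q : ↥(lamFree P.L (Mk P k) Λ'₀), elimLam P.L (Mk P k) Λ'₀ (idx P k b) q ≠ 0 ∧
          memX (fun (x : B4.Idx (pbox (Mk P k)) P.d) (l : ↥(labels Mc (pbox (Mk P k)))) => InBox Mc l.1 (x.1 : Fin P.d → ℤ)) (cubeOf Mc s) touch
            (q : B4.Idx (pbox (Mk P k)) P.d) X)
        (fun X b b' => sandw P.L (Mk P k) Λ'₀ (cX (ldist (N := P.d) Mc) ((s : ℝ) / 4) (cubeOf Mc s) touch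
          (walkK P.L (Mk P k) Λ'₀ (reDelK (P.L ^ k) (one_le_Lpow P k) (Mk P k)) (gamma2153one P.d P.L) Mc) X) (idx P k b) (idx P k b'))
        (δ₀ / (256 * 9 ^ P.d)) s) := by
  obtain ⟨c₀, δ₀, Mc, s₀, hc, hδ, hM5, H⟩ := eq249_DelK_uniform (d := d) (L := L) hd2 hL
  refine ⟨c₀, δ₀, Mc, s₀, hc, hδ, hM5, fun P hPd hPL k _ hk Λ'₀ hbox => ?_⟩
  subst hPd hPL
  obtain ⟨h245, hsum, hdec, hclose, h246⟩ := H (Mk P k) (L_dvd_Mk hk) (P.L ^ k) (one_le_Lpow P k) Λ'₀ hbox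
  refine ⟨fun ρ s b b' => ?_, fun b b' => ?_, fun b b' => ?_, fun ρ b b' => ?_, fun s hs => ?_⟩
  · dsimp only
    rw [kernel_cornerLam_eq_cov hd2 hk]
    exact h245 ρ s (idx P k b) (idx P k b')
  · rw [kernel_cornerLam_eq_cov hd2 hk]; exact hsum (idx P k b) (idx P k b')
  · rw [kernel_cornerLam_eq_cov hd2 hk]
    have h := hdec (idx P k b) (idx P k b')
    rwa [idx_fst_coe, idx_fst_coe, pdist_rep_eq_supDist] at h
  · have h := close_idx (P := P) (k := k) (hclose ρ) b b'
    dsimp only at h ⊢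
    rw [kernel_cornerLam_eq_cov hd2 hk]
    exact h
  · exact ineq246_idx (P := P) (k := k) (h246 s hs)

/-- **(2.49) AND ITS ESTIMATES FOR THE (4.3.3) DIRICHLET PROPAGATOR ON `Wstep_Λ` (ONE-STEP AXIAL GAUGE OF [I]), ALL CONSTANTS FROM `(d, L)`** —
`C_{Wstep,Λ} = T̂·(C^{(k)}_Λ∘idx)·T̂ᵀ` (gen 24's `kernel_stepLam_eq_cov` after p27/p09): `c₀, δ₀ > 0`, a cube size `M_c ≥ 5` and a label count `s₀`
such that for every torus `Params` with these `(d, L)`, every `k + 1 ≤ m + K`, every `Λ′₀` in half-torus position: (2.49) `Eq245` with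
`C_{loc} = T̂(C_ΛC_{loc}[A]C_Λᵀ∘idx)T̂ᵀ`, `C_X = T̂(C_ΛC_X[A]C_Λᵀ∘idx)T̂ᵀ` (every `ρ`, `s`); (2.42); the (2.41)/(7.2.3)-shape decay
`2^{d+1}γ′^{−1}e^{δ₀/4}e^{2δ′(L−1)}(L^d+1)²·e^{2δ′L}rowBound(d,L)²·e^{−δ′|b₋−b′₋|}` — [I] p. 325 *"uniformly in Λ"*, here also in `k` and the volume;
(2.47) `Close` in `supDist`; (2.46) `Ineq246` with `c = δ₀/(512·9^d)` for every `s ≥ s₀` (support widened by the range `L` of `T̂`).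
[cite: BalabanImbrieJaffe1988, (2.49) p.265, (2.41)–(2.47) pp.264–265; BalabanImbrieJaffe1985, (4.3.3) p.311, (7.2.3) p.325] -/
theorem eq249_stepLam_uniform (d L : ℕ) (hd2 : 2 ≤ d) (hL : 1 ≤ L) :
    ∃ c₀ δ₀ : ℝ, ∃ Mc s₀ : ℕ, 0 < c₀ ∧ 0 < δ₀ ∧ 5 ≤ Mc ∧ ∀ (P : Params), P.d = d → P.L = L → ∀ (k : ℕ) [DecidableEq (PBond P k)]
      (hk : k + 1 ≤ P.m + P.K) (Λ'₀ : Finset (Fin P.d → ℤ)), HalfBox P.L (Mk P k) Λ'₀ →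
      (∀ (ρ : ℝ) (s : ℕ), BIJ88Sect2Statements.Eq245
        (fun b b' : PBond P k =>
          unitPropagator (V411 P k) (curlOp (P := P) (P.eta k ^ P.d) ((P.L : ℝ) ^ k)) (QsE P k) (WstepLam P k Λ'₀) (EuclideanSpace.single b' 1) b)
        (fun b b' => (regaugeMat P k * Matrix.of (fun a a' : PBond P k => sandw P.L (Mk P k) Λ'₀ (cLoc (ldist (N := P.d) Mc) ρ
            (walkK P.L (Mk P k) Λ'₀ (reDelK (P.L ^ k) (one_le_Lpow P k) (Mk P k)) (gamma2153one P.d P.L) Mc)) (idx P k a) (idx P k a')) *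
          (regaugeMat P k)ᵀ) b b')
        (fun (X : Finset (Cubes Mc s (pbox (Mk P k)))) b b' => (regaugeMat P k * Matrix.of (fun a a' : PBond P k =>
            sandw P.L (Mk P k) Λ'₀ (cX (ldist (N := P.d) Mc) ρ (cubeOf Mc s) touch
              (walkK P.L (Mk P k) Λ'₀ (reDelK (P.L ^ k) (one_le_Lpow P k) (Mk P k)) (gamma2153one P.d P.L) Mc) X) (idx P k a) (idx P k a')) *
          (regaugeMat P k)ᵀ) b b')) ∧
      (∀ b b' : PBond P k, HasSum (fun ω => (regaugeMat P k * Matrix.of (fun a a' : PBond P k => sandw P.L (Mk P k) Λ'₀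
            (walkK P.L (Mk P k) Λ'₀ (reDelK (P.L ^ k) (one_le_Lpow P k) (Mk P k)) (gamma2153one P.d P.L) Mc ω) (idx P k a) (idx P k a')) *
          (regaugeMat P k)ᵀ) b b')
        (unitPropagator (V411 P k) (curlOp (P := P) (P.eta k ^ P.d) ((P.L : ℝ) ^ k)) (QsE P k) (WstepLam P k Λ'₀) (EuclideanSpace.single b' 1) b)) ∧
      (∀ b b' : PBond P k,
        |unitPropagator (V411 P k) (curlOp (P := P) (P.eta k ^ P.d) ((P.L : ℝ) ^ k)) (QsE P k) (WstepLam P k Λ'₀) (EuclideanSpace.single b' 1) b| ≤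
          2 ^ (P.d + 1) * (gamma2153one P.d P.L)⁻¹ * Real.exp (δ₀ / 4) * Real.exp (2 * (δ₀ / 8 / Mc) * ((P.L : ℝ) - 1)) * ((P.L : ℝ) ^ P.d + 1) *
            ((P.L : ℝ) ^ P.d + 1) * Real.exp (2 * (δ₀ / 8 / Mc) * P.L) * rowBound P.d P.L * rowBound P.d P.L *
            Real.exp (-(δ₀ / 8 / Mc * (supDist b.src b'.src : ℝ)))) ∧
      (∀ ρ : ℝ, BIJ88Sect2Statements.Close (fun b b' : PBond P k => (supDist b.src b'.src : ℝ))
        (fun b b' => (regaugeMat P k * Matrix.of (fun a a' : PBond P k => sandw P.L (Mk P k) Λ'₀ (cLoc (ldist (N := P.d) Mc) ρ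
            (walkK P.L (Mk P k) Λ'₀ (reDelK (P.L ^ k) (one_le_Lpow P k) (Mk P k)) (gamma2153one P.d P.L) Mc)) (idx P k a) (idx P k a')) *
          (regaugeMat P k)ᵀ) b b')
        (fun b b' : PBond P k =>
          unitPropagator (V411 P k) (curlOp (P := P) (P.eta k ^ P.d) ((P.L : ℝ) ^ k)) (QsE P k) (WstepLam P k Λ'₀) (EuclideanSpace.single b' 1) b)
        ((2 ^ (P.d + 1) * (gamma2153one P.d P.L)⁻¹ * Real.exp (-(δ₀ / 16 * (ρ - 3))) * Real.exp (2 * (δ₀ / 16 / Mc) * ((P.L : ℝ) - 1)) *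
            ((P.L : ℝ) ^ P.d + 1) * ((P.L : ℝ) ^ P.d + 1)) * Real.exp (2 * (δ₀ / 16 / Mc) * P.L) * rowBound P.d P.L * rowBound P.d P.L)
        (δ₀ / 16 / Mc)) ∧
      (∀ s : ℕ, s₀ ≤ s → BIJ88Sect2Statements.Ineq246 (fun X : Finset (Cubes Mc s (pbox (Mk P k))) => X.card)
        (fun (b : PBond P k) (X : Finset (Cubes Mc s (pbox (Mk P k)))) => ∃ a : PBond P k, supDist b.src a.src ≤ P.L ∧
          ∃ q : ↥(lamFree P.L (Mk P k) Λ'₀), elimLam P.L (Mk P k) Λ'₀ (idx P k a) q ≠ 0 ∧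
            memX (fun (x : B4.Idx (pbox (Mk P k)) P.d) (l : ↥(labels Mc (pbox (Mk P k)))) => InBox Mc l.1 (x.1 : Fin P.d → ℤ)) (cubeOf Mc s) touch
              (q : B4.Idx (pbox (Mk P k)) P.d) X)
        (fun X b b' => (regaugeMat P k * Matrix.of (fun a a' : PBond P k =>
            sandw P.L (Mk P k) Λ'₀ (cX (ldist (N := P.d) Mc) ((s : ℝ) / 4) (cubeOf Mc s) touch
              (walkK P.L (Mk P k) Λ'₀ (reDelK (P.L ^ k) (one_le_Lpow P k) (Mk P k)) (gamma2153one P.d P.L) Mc) X) (idx P k a) (idx P k a')) *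
          (regaugeMat P k)ᵀ) b b')
        (δ₀ / (256 * 9 ^ P.d) / 2) s) := by
  obtain ⟨c₀, δ₀, Mc, s₀, hc, hδ, hM5, H⟩ := eq249_DelK_uniform (d := d) (L := L) hd2 hL
  -- one more largeness condition for (2.46): `rowBound(d,L)² ≤ e^{(δ₀/(512·9^d))s}`
  refine ⟨c₀, δ₀, Mc, max s₀ ⌈(rowBound d L * rowBound d L) / (δ₀ / (256 * 9 ^ d) / 2)⌉₊, hc, hδ, hM5,
    fun P hPd hPL k _ hk Λ'₀ hbox => ?_⟩
  subst hPd hPL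
  obtain ⟨h245, hsum, hdec, hclose, h246⟩ := H (Mk P k) (L_dvd_Mk hk) (P.L ^ k) (one_le_Lpow P k) Λ'₀ hbox
  have hγ : 0 < gamma2153one P.d P.L := gamma2153one_pos (by omega) hL
  refine ⟨fun ρ s => ?_, fun b b' => ?_, fun b b' => ?_, fun ρ => ?_, fun s hs => ?_⟩
  · have h1 : BIJ88Sect2Statements.Eq245
        (fun b b' : PBond P k => (bondReductionLam P.L (Mk P k) Λ'₀ (reDelK (P.L ^ k) (one_le_Lpow P k) (Mk P k))).cov (idx P k b) (idx P k b'))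
        (fun b b' => sandw P.L (Mk P k) Λ'₀ (cLoc (ldist (N := P.d) Mc) ρ
          (walkK P.L (Mk P k) Λ'₀ (reDelK (P.L ^ k) (one_le_Lpow P k) (Mk P k)) (gamma2153one P.d P.L) Mc)) (idx P k b) (idx P k b'))
        (fun (X : Finset (Cubes Mc s (pbox (Mk P k)))) b b' => sandw P.L (Mk P k) Λ'₀ (cX (ldist (N := P.d) Mc) ρ (cubeOf Mc s) touch
          (walkK P.L (Mk P k) Λ'₀ (reDelK (P.L ^ k) (one_le_Lpow P k) (Mk P k)) (gamma2153one P.d P.L) Mc) X) (idx P k b) (idx P k b')) :=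
      fun b b' => h245 ρ s (idx P k b) (idx P k b')
    intro b b'
    have h2 := eq245_tsandw h1 b b'
    dsimp only at h2 ⊢
    rw [kernel_stepLam_eq_cov hd2 hk]
    exact h2
  · rw [kernel_stepLam_eq_cov hd2 hk]
    exact hasSum_tsandw (fun a a' => by rw [Matrix.of_apply]; exact hsum (idx P k a) (idx P k a')) b b'
  · rw [kernel_stepLam_eq_cov hd2 hk]
    have hK₁ : 0 ≤ 2 ^ (P.d + 1) * (gamma2153one P.d P.L)⁻¹ * Real.exp (δ₀ / 4) * Real.exp (2 * (δ₀ / 8 / Mc) * ((P.L : ℝ) - 1)) *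
        ((P.L : ℝ) ^ P.d + 1) * ((P.L : ℝ) ^ P.d + 1) := by positivity
    exact abs_tsandw_le_of_decay hk hK₁ (by positivity) (fun a a' => by
      rw [Matrix.of_apply]
      have h := hdec (idx P k a) (idx P k a')
      rwa [idx_fst_coe, idx_fst_coe, pdist_rep_eq_supDist] at h) b b'
  · have hδ' : 0 ≤ 2 ^ (P.d + 1) * (gamma2153one P.d P.L)⁻¹ * Real.exp (-(δ₀ / 16 * (ρ - 3))) *
        Real.exp (2 * (δ₀ / 16 / Mc) * ((P.L : ℝ) - 1)) * ((P.L : ℝ) ^ P.d + 1) * ((P.L : ℝ) ^ P.d + 1) := by positivity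
    have hcl := close_tsandw hk hδ' (by positivity) (close_idx (P := P) (k := k) (hclose ρ))
    intro b b'
    have h1 := hcl b b'
    dsimp only at h1 ⊢
    rw [kernel_stepLam_eq_cov hd2 hk]
    exact h1
  · have hs₀ : s₀ ≤ s := (le_max_left _ _).trans hs
    have h := ineq246_idx (P := P) (k := k) (h246 s hs₀)
    have hlarge : rowBound P.d P.L * rowBound P.d P.L ≤ Real.exp (δ₀ / (256 * 9 ^ P.d) / 2 * s) := by
      refine le_exp_mul_of_ge (by positivity) ?_
      have h2 : ⌈(rowBound P.d P.L * rowBound P.d P.L) / (δ₀ / (256 * 9 ^ P.d) / 2)⌉₊ ≤ s := (le_max_right _ _).trans hs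
      exact (Nat.le_ceil _).trans (by exact_mod_cast h2)
    refine ineq246_tsandw hk (by positivity) (Nat.cast_nonneg s) h (fun X hX x hm => ?_) hlarge
    obtain ⟨q, -, j, -, hj⟩ := hm
    have hmem := hj (subset_closure touch {cubeOf Mc s j} (Finset.mem_singleton_self _))
    rw [Finset.card_eq_zero.mp hX] at hmem
    exact Finset.notMem_empty _ hmem

end BIJ85
end

end Literature.MathematicalPhysics.QuantumFieldTheory.BalabanImbrieJaffe1984to88.BIJ88Eq249GaugeCovarianceUniformTorus
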